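import Summits.AtomisticToContinuum.BoseEinsteinCondensation.Theorems.PeriodicIRBound.Negative.GroundOccupation
import Literature.MathematicalPhysics.QuantumManyBody.PeriodicBoseGasMomentumSector
import Literature.MathematicalPhysics.QuantumManyBody.PeriodicBoseGasScattering
import Mathlib.MeasureTheory.Measure.Lebesgue.EqHaar

/-!
# Negative lemmas for crux `PeriodicIRBound` (stmt-AtomisticToContinuum-3972), XII: the crux sees only
the a.e.-class of the potential; WLOG `a > 0`

Supports (does not close) stmt-AtomisticToContinuum-3972, route `BECGroundStateSOS`. Landed copy of
§21 of `Cruxes/PeriodicIRBound/Disproof.lean` (cycle 3, gen-3 disprover seat); all `sorry`-free,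
axioms `propext`/`Classical.choice`/`Quot.sound`. No theorem below asserts a Theses decl positively
(the positive statements are per-potential instances `IRBoundFor v` for a.e.-free `v`, as
`irBoundFor_zero` of `Negative.FreeGas`).

* `shear`, `ae_pairDiff` — pair differences `Xᵢ - Xⱼ` (`i ≠ j`) are quasi-measure-preserving on
  `(ℝ³)^N` (Haar change of variables under the unimodular shear, then `quasiMeasurePreserving_eval`).
* `periodizedPotential_congr_ae`, `periodicInteraction_congr_ae`, `periodicEnergy_congr_ae` —
  a.e.-equal radial profiles have IDENTICAL quadratic forms on every periodic trial state; hence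
  `periodicGroundStateEnergy_congr_ae`, `momentumSectorEnergy_congr_ae`, `groundOccupation_congr_ae`,
  `nearMin_congr_ae`, `irBoundWith_congr_ae`, `irBoundFor_congr_ae`.
* `irBoundFor_of_ae_zero`, `irBoundFor_of_scatteringLength_eq_zero` — the a.e.-free half of the
  crux is TRUE (`a = 0 ⇒ v(|·|) = 0` a.e. by `LSSY2005_zeroScatteringLength_holds`, then
  `irBoundFor_zero`); `periodicIRBound_iff_pos_scatteringLength` — the crux is equivalent to its
  restriction to `0 < scatteringLength v`: any counterexample must interact.
-/

noncomputable section

open MeasureTheory Filter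
open scoped ENNReal NNReal ComplexConjugate BigOperators
namespace Summit.AtomisticToContinuum.BoseEinsteinCondensation.Theorems.PeriodicIRBound.Negative

open Literature.MathematicalPhysics.QuantumManyBody.BoseGas
open Summit.AtomisticToContinuum.BoseEinsteinCondensation.Theses.BECGroundStateSOS

variable {L : ℝ}

/-! ## §21 The crux sees `v` only through the a.e.-class of `x ↦ v(|x|)` on `ℝ³`; WLOG `a > 0`

(cycle 3) The pair interaction enters the quadratic form only through `∫ v^per(Xᵢ - Xⱼ)|Ψ|² dX`, and
pair differences are quasi-measure-preserving (`ae_pairDiff`, via the unimodular shear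
`X ↦ (…, Xᵢ - Xⱼ, …)`), so a.e.-equal radial profiles give IDENTICAL energies of every trial state
(`periodicEnergy_congr_ae`), hence identical `E₀^{per}`, sector energies, near-minimiser sets and
ground-state occupations. Consequences: the crux for `v` depends only on the a.e.-class of `v ∘ |·|`
(`irBoundFor_congr_ae`) — e.g. `v = ⊤·1_S` with `S` Lebesgue-null is an a.e.-FREE gas; the a.e.-free
half of the crux is TRUE (`irBoundFor_of_ae_zero`, `irBoundFor_of_scatteringLength_eq_zero`, using
the tree's `LSSY2005_zeroScatteringLength_holds : a = 0 ⇒ v(|·|) = 0` a.e.); and the crux is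
EQUIVALENT to its restriction to `0 < scatteringLength v` (`periodicIRBound_iff_pos_scatteringLength`).
Any counterexample must genuinely interact (`a > 0`); case (i) `∫v = 0` of the line's `stub_transfer`
is discharged by `irBoundFor_of_ae_zero`. -/

section AEClass

variable {N : ℕ}

/-- The shear `X ↦ (X₁, …, Xᵢ - Xⱼ, …, X_N)` (`i ≠ j`), a linear automorphism of configuration
space. [folklore] -/
def shear (i j : Fin N) (hij : i ≠ j) : Config N ≃ₗ[ℝ] Config N where
  toFun X := Function.update X i (X i - X j)
  invFun X := Function.update X i (X i + X j)
  map_add' X Y := by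
    funext l
    by_cases hl : l = i
    · subst hl
      simp only [Function.update_self, Pi.add_apply]
      abel
    · simp only [Function.update_of_ne hl, Pi.add_apply]
  map_smul' c X := by
    funext l
    by_cases hl : l = i
    · subst hl
      simp only [Function.update_self, Pi.smul_apply, RingHom.id_apply, smul_sub]
    · simp only [Function.update_of_ne hl, Pi.smul_apply, RingHom.id_apply]
  left_inv X := by
    simp only [Function.update_self, Function.update_of_ne hij.symm, Function.update_idem,
      sub_add_cancel, Function.update_eq_self]
  right_inv X := by
    simp only [Function.update_self, Function.update_of_ne hij.symm, Function.update_idem,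
      add_sub_cancel_right, Function.update_eq_self]

/-- The shear's `i`-th output is the pair difference. [folklore] -/
theorem shear_apply_same (i j : Fin N) (hij : i ≠ j) (X : Config N) :
    shear i j hij X i = X i - X j := by
  simp [shear]

/-- **Pair differences are quasi-measure-preserving**: an a.e. property of `x ∈ ℝ³` holds at
`Xᵢ - Xⱼ` for a.e. configuration `X ∈ (ℝ³)^N` (`i ≠ j`; Haar change of variables under the shear,
then `quasiMeasurePreserving_eval`). [folklore] -/
theorem ae_pairDiff {i j : Fin N} (hij : i ≠ j) {p : Space → Prop} (h : ∀ᵐ x : Space, p x) :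
    ∀ᵐ X : Config N, p (X i - X j) := by
  rw [ae_iff] at h ⊢
  have hset : {X : Config N | ¬ p (X i - X j)} =
      (shear i j hij) ⁻¹' (Function.eval i ⁻¹' {x : Space | ¬ p x}) := by
    ext X
    simp only [Set.mem_setOf_eq, Set.mem_preimage, Function.eval, shear_apply_same]
  have hpi : (volume : Measure (Config N)) (Function.eval i ⁻¹' {x : Space | ¬ p x}) = 0 :=
    (Measure.quasiMeasurePreserving_eval (fun _ : Fin N => (volume : Measure Space)) i).preimage_null h
  rw [hset, Measure.addHaar_preimage_linearEquiv (volume : Measure (Config N)) (shear i j hij), hpi,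
    mul_zero]

/-- A.e.-equal radial profiles have a.e.-equal periodisations (countably many translates).
[folklore] -/
theorem periodizedPotential_congr_ae {v w : ℝ → ℝ≥0∞} (h : ∀ᵐ x : Space, v ‖x‖ = w ‖x‖) (L : ℝ) :
    ∀ᵐ x : Space, periodizedPotential v L x = periodizedPotential w L x := by
  have hn : ∀ n : Fin 3 → ℤ, ∀ᵐ x : Space, v ‖x - latticeVec L n‖ = w ‖x - latticeVec L n‖ :=
    fun n => (measurePreserving_sub_right (volume : Measure Space)
      (latticeVec L n)).quasiMeasurePreserving.ae h
  filter_upwards [ae_all_iff.2 hn] with x hx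
  unfold periodizedPotential
  exact tsum_congr hx

/-- … hence a.e.-equal periodic interactions on configuration space. [folklore] -/
theorem periodicInteraction_congr_ae {v w : ℝ → ℝ≥0∞} (h : ∀ᵐ x : Space, v ‖x‖ = w ‖x‖) (L : ℝ) :
    ∀ᵐ X : Config N, periodicInteraction v L X = periodicInteraction w L X := by
  have hpair : ∀ i j : Fin N, ∀ᵐ X : Config N, i ≠ j →
      periodizedPotential v L (X i - X j) = periodizedPotential w L (X i - X j) := by
    intro i j
    by_cases hij : i = j
    · exact Eventually.of_forall fun X h => absurd hij h
    · filter_upwards [ae_pairDiff hij (periodizedPotential_congr_ae h L)] with X hX _ using hX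
  filter_upwards [ae_all_iff.2 fun i => ae_all_iff.2 (hpair i)] with X hX
  unfold periodicInteraction
  refine Finset.sum_congr rfl fun i _ => Finset.sum_congr rfl fun j hj => ?_
  rw [Finset.mem_filter] at hj
  exact hX i j (ne_of_lt hj.2)

/-- **The periodic energy sees only the a.e.-class of `x ↦ v(|x|)`**: a.e.-equal radial
potentials have IDENTICAL quadratic forms on every periodic trial state. [folklore] -/
theorem periodicEnergy_congr_ae {v w : ℝ → ℝ≥0∞} (h : ∀ᵐ x : Space, v ‖x‖ = w ‖x‖)
    (Ψ : PeriodicTrialState N L) : periodicEnergy v Ψ = periodicEnergy w Ψ := by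
  unfold periodicEnergy
  refine lintegral_congr_ae (ae_restrict_of_ae ?_)
  filter_upwards [periodicInteraction_congr_ae (N := N) h L] with X hX
  rw [hX]

/-- … identical ground-state energies. [folklore] -/
theorem periodicGroundStateEnergy_congr_ae {v w : ℝ → ℝ≥0∞} (h : ∀ᵐ x : Space, v ‖x‖ = w ‖x‖)
    (N : ℕ) (L : ℝ) : periodicGroundStateEnergy v N L = periodicGroundStateEnergy w N L := by
  unfold periodicGroundStateEnergy
  exact iInf_congr fun Ψ => periodicEnergy_congr_ae h Ψ

/-- … identical momentum-sector energies. [folklore] -/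
theorem momentumSectorEnergy_congr_ae {v w : ℝ → ℝ≥0∞} (h : ∀ᵐ x : Space, v ‖x‖ = w ‖x‖)
    (N : ℕ) (L : ℝ) (k : Space) : momentumSectorEnergy v N L k = momentumSectorEnergy w N L k := by
  unfold momentumSectorEnergy
  exact iInf_congr fun Ψ => iInf_congr fun _ => periodicEnergy_congr_ae h Ψ

/-- … identical ground-state occupations `γ_N(k)` (§11). [folklore] -/
theorem groundOccupation_congr_ae {v w : ℝ → ℝ≥0∞} (h : ∀ᵐ x : Space, v ‖x‖ = w ‖x‖)
    (N : ℕ) (L : ℝ) (k : Fin 3 → ℤ) : groundOccupation v N L k = groundOccupation w N L k := by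
  unfold groundOccupation
  simp only [periodicEnergy_congr_ae h, periodicGroundStateEnergy_congr_ae h]

/-- … identical near-minimiser sets. [folklore] -/
theorem nearMin_congr_ae {v w : ℝ → ℝ≥0∞} (h : ∀ᵐ x : Space, v ‖x‖ = w ‖x‖) (ρ : ℝ) (N : ℕ)
    (δ : ℝ≥0∞) (Ψ : PeriodicTrialState N (sideLength ρ N)) :
    NearMin v ρ N δ Ψ ↔ NearMin w ρ N δ Ψ := by
  unfold NearMin
  rw [periodicEnergy_congr_ae h, periodicGroundStateEnergy_congr_ae h]

/-- … the same infrared bounds with the same constants. [folklore] -/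
theorem irBoundWith_congr_ae {v w : ℝ → ℝ≥0∞} (h : ∀ᵐ x : Space, v ‖x‖ = w ‖x‖) (κ ρ₀ C : ℝ) :
    IRBoundWith v κ ρ₀ C ↔ IRBoundWith w κ ρ₀ C := by
  unfold IRBoundWith
  simp only [nearMin_congr_ae h]

/-- **The crux for `v` is the crux for any a.e.-equal `w`.** [folklore] -/
theorem irBoundFor_congr_ae {v w : ℝ → ℝ≥0∞} (h : ∀ᵐ x : Space, v ‖x‖ = w ‖x‖) :
    IRBoundFor v ↔ IRBoundFor w := by
  unfold IRBoundFor
  simp only [nearMin_congr_ae h]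

/-- **The a.e.-free half of the crux is TRUE**: if `v(|x|) = 0` for a.e. `x ∈ ℝ³` then
`IRBoundFor v` (by §9 `irBoundFor_zero`: kinetic Markov bound, any `C > 0`). This is case (i)
(`∫v = 0`) of the line's `stub_transfer`, discharged. [folklore] -/
theorem irBoundFor_of_ae_zero {v : ℝ → ℝ≥0∞} (h : ∀ᵐ x : Space, v ‖x‖ = 0) : IRBoundFor v :=
  (irBoundFor_congr_ae (w := 0) (by simpa using h)).2 irBoundFor_zero

/-- … in particular for every admissible `v` of scattering length ZERO (`a = 0` forces
`v(|·|) = 0` a.e.: the tree's `LSSY2005_zeroScatteringLength_holds`). [folklore] -/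
theorem irBoundFor_of_scatteringLength_eq_zero {v : ℝ → ℝ≥0∞} (hv : IsRepulsiveFiniteRange v)
    (ha : scatteringLength v = 0) : IRBoundFor v := by
  obtain ⟨R₀, hR₀⟩ := hv.2
  exact irBoundFor_of_ae_zero (LSSY2005_zeroScatteringLength_holds v R₀ hv.1 hR₀ ha)

/-- **Normal form — WLOG `a > 0`.** The crux is equivalent to its restriction to admissible
potentials of POSITIVE scattering length; the `a = 0` class (a.e.-free gases, e.g. `v = ⊤·1_S`
with `S` Lebesgue-null) is settled by the kinetic Markov bound. Any counterexample must interact.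
[folklore] -/
theorem periodicIRBound_iff_pos_scatteringLength :
    PeriodicIRBound ↔
      ∀ v, IsRepulsiveFiniteRange v → 0 < scatteringLength v → IRBoundFor v := by
  rw [periodicIRBound_iff]
  refine ⟨fun h v hv _ => h v hv, fun h v hv => ?_⟩
  rcases eq_or_ne (scatteringLength v) 0 with ha | ha
  · exact irBoundFor_of_scatteringLength_eq_zero hv ha
  · exact h v hv (pos_iff_ne_zero.2 ha)

end AEClass


end Summit.AtomisticToContinuum.BoseEinsteinCondensation.Theorems.PeriodicIRBound.Negative

end
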